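import Mathlib
import HarnessLib
import Summits.Ventures.LatticeQCDFlow.Scaling.KLVolumeLawPi

/-!
# LatticeQCDFlow / Scaling — the centred second moment of a SUM OF INDEPENDENT BLOCK TERMS under a
# product kernel on `Measure.pi`: `∫ (∏ᵢ kᵢ(xᵢ))·(Σᵢ gᵢ(xᵢ))² = Σᵢ (∫kᵢ gᵢ²)·∏_{l ≠ i} ∫k_l` when
# every `∫ kᵢ gᵢ = 0`

HONEST FRAMING: exact (Metropolis-corrected) sampling algorithms for lattice gauge theory;
figures of merit are autocorrelation/cost numbers at stated couplings and volumes; no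
continuum-physics claim.

Venture `LatticeQCDFlow` (cell pub-lqcd), topic `Scaling`; FANOUT row 3 (`s0-u1-a`, S0-B
implementation A, GEN-15).  Folklore-level Fubini bookkeeping over a finite product of measure
spaces ("the variance of a sum of independent variables is the sum of the variances", written on
densities without probability-space vocabulary), isolated here because it is the engine of the
companion file `Scaling/AcceptanceVolumeRatePi` (the exact exponential rate of the acceptance
volume law).  Row 3's `Scaling/AcceptanceVolumeFloorPi` and `Scaling/KLVolumeLawPi` (GEN-12,
imported) supply the one-coordinate Fubini `integral_mul_prod_erase_pi` and its integrability
companion `integrable_mul_prod_erase_pi`.  NO definition is introduced.  SETTING: a finite block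
index `ι`, block spaces `X i` with σ-finite measures `ν i`, `Measure.pi ν` on `Π i, X i`, block
kernels `kᵢ ≥ 0` with the product kernel `K(x) = ∏ᵢ kᵢ(xᵢ)`, block functions `gᵢ` and the sum
`G(x) = Σᵢ gᵢ(xᵢ)` (blocks may differ — sizes, couplings, boundary blocks).

* §1 algebra of marked coordinates: `mul_mul_prod_erase_erase`, `piKernel_mul_sq_eq`,
  `piKernel_mul_eq`, `piKernel_mul_mul_eq` (`K·gᵢ(xᵢ)gⱼ(xⱼ) = (kᵢgᵢ)(xᵢ)(kⱼgⱼ)(xⱼ)∏_{l ≠ i,j} k_l(x_l)`);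
* §2 **`integral_mul_mul_prod_erase_erase_pi`** — TWO-COORDINATE FUBINI
  `∫ ψ(xᵢ)χ(xⱼ)∏_{l ≠ i,j} k_l(x_l) d(⊗ν) = (∫ψ dνᵢ)(∫χ dνⱼ)∏_{l ≠ i,j}∫k_l dν_l` (`i ≠ j`);
  `integrable_piKernel_mul_mul`, `integrable_piKernel_mul_sum_sq`, `integrable_piKernel_mul_sum`
  (`K gᵢ(xᵢ)gⱼ(xⱼ)`, `K G²`, `K G ∈ L¹(⊗ν)` once `kᵢ, kᵢ gᵢ, kᵢ gᵢ² ∈ L¹(νᵢ)`);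
  **`integral_piKernel_mul_sq_sum`** — for `∫ kᵢ gᵢ dνᵢ = 0` (all `i`):
  `∫ K(x) G(x)² d(⊗ν) = Σᵢ (∫ kᵢ gᵢ² dνᵢ)·∏_{l ≠ i} ∫ k_l dν_l` (every off-diagonal term carries a
  factor `∫ kᵢ gᵢ = 0` — independence of the blocks); identical blocks:
  **`integral_piKernel_mul_sq_sum_const`** `= m·(∫ k g²)·(∫ k)^{m−1}`, `m = card ι`;
* §3 pointwise bookkeeping for product densities `P = ∏ pᵢ(xᵢ)`, `Q = ∏ qᵢ(xᵢ)`: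
  `sqrt_piDensity_mul` (`√(PQ) = ∏ √(pᵢ qᵢ)(xᵢ)`), `log_piDensity_div` (on the support of the
  kernel, `log(P/Q) = Σ log(pᵢ/qᵢ)(xᵢ)`), **`piKernel_mul_abs_log_sub`** (the pair kernel
  `K(x)K(x′)` sees the log-weight gap of the products as the gap of the centred SUMS of block log
  weights, for any centring constants `cᵢ, dᵢ`).

NOT CLAIMED: anything about samplers beyond bookkeeping; no number of ours.
-/

namespace Summit.Ventures.LatticeQCDFlow.Theory2

open MeasureTheory Finset Filter

/-! ## §1 Algebra of marked coordinates -/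

section Algebra

variable {ι : Type*} [Fintype ι] [DecidableEq ι] {X : ι → Type*}

/-- Two marked coordinates `i ≠ j` as one marked coordinate of an updated family:
`ψ(xᵢ)χ(xⱼ)∏_{l ≠ i, j} k_l(x_l) = ψ(xᵢ)·∏_{l ≠ i} (k updated at j by χ)_l(x_l)`. [folklore] -/
theorem mul_mul_prod_erase_erase {i j : ι} (hij : i ≠ j) (ψ : X i → ℝ) (χ : X j → ℝ)
    (k : (l : ι) → X l → ℝ) (x : (l : ι) → X l) :
    ψ (x i) * χ (x j) * ∏ l ∈ (univ.erase i).erase j, k l (x l)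
      = ψ (x i) * ∏ l ∈ univ.erase i, Function.update k j χ l (x l) := by
  have hj : j ∈ univ.erase i := mem_erase.2 ⟨hij.symm, mem_univ j⟩
  rw [← mul_prod_erase (univ.erase i) (fun l => Function.update k j χ l (x l)) hj,
    Function.update_self, mul_assoc]
  congr 2
  exact prod_congr rfl fun l hl => by rw [Function.update_of_ne (ne_of_mem_erase hl)]

/-- The product kernel with one squared block term factorises:
`K(x)·gᵢ(xᵢ)² = (kᵢ gᵢ²)(xᵢ)·∏_{l ≠ i} k_l(x_l)`. [folklore] -/
theorem piKernel_mul_sq_eq (k g : (l : ι) → X l → ℝ) (i : ι) (x : (l : ι) → X l) :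
    (∏ l, k l (x l)) * g i (x i) ^ 2 = k i (x i) * g i (x i) ^ 2 * ∏ l ∈ univ.erase i, k l (x l) := by
  rw [← mul_prod_erase univ (fun l => k l (x l)) (mem_univ i)]
  ring

/-- The product kernel with one block term factorises: `K(x)·gᵢ(xᵢ) = (kᵢ gᵢ)(xᵢ)·∏_{l ≠ i} k_l(x_l)`.
[folklore] -/
theorem piKernel_mul_eq (k g : (l : ι) → X l → ℝ) (i : ι) (x : (l : ι) → X l) :
    (∏ l, k l (x l)) * g i (x i) = k i (x i) * g i (x i) * ∏ l ∈ univ.erase i, k l (x l) := by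
  rw [← mul_prod_erase univ (fun l => k l (x l)) (mem_univ i)]
  ring

/-- The product kernel with two distinct block terms factorises:
`K(x)·gᵢ(xᵢ)gⱼ(xⱼ) = (kᵢgᵢ)(xᵢ)(kⱼgⱼ)(xⱼ)·∏_{l ≠ i, j} k_l(x_l)`. [folklore] -/
theorem piKernel_mul_mul_eq (k g : (l : ι) → X l → ℝ) {i j : ι} (hij : i ≠ j) (x : (l : ι) → X l) :
    (∏ l, k l (x l)) * (g i (x i) * g j (x j))
      = k i (x i) * g i (x i) * (k j (x j) * g j (x j)) * ∏ l ∈ (univ.erase i).erase j, k l (x l) := by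
  have hj : j ∈ univ.erase i := mem_erase.2 ⟨hij.symm, mem_univ j⟩
  rw [← mul_prod_erase univ (fun l => k l (x l)) (mem_univ i),
    ← mul_prod_erase (univ.erase i) (fun l => k l (x l)) hj]
  ring

end Algebra

/-! ## §2 Two-coordinate Fubini on `Measure.pi`; the centred second moment of a sum -/

section Engine

variable {ι : Type*} [Fintype ι] [DecidableEq ι] {X : ι → Type*} [∀ i, MeasurableSpace (X i)]
  {ν : (i : ι) → Measure (X i)} [∀ i, SigmaFinite (ν i)]

/-- **Two-coordinate Fubini over `Measure.pi`**: for `i ≠ j`,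
`∫ ψ(xᵢ)χ(xⱼ)∏_{l ≠ i, j} k_l(x_l) d(⊗ν) = (∫ψ dνᵢ)(∫χ dνⱼ)·∏_{l ≠ i, j} ∫k_l dν_l`. [folklore] -/
theorem integral_mul_mul_prod_erase_erase_pi {i j : ι} (hij : i ≠ j) (ψ : X i → ℝ) (χ : X j → ℝ)
    (k : (l : ι) → X l → ℝ) :
    ∫ x, ψ (x i) * χ (x j) * ∏ l ∈ (univ.erase i).erase j, k l (x l) ∂(Measure.pi ν)
      = (∫ a, ψ a ∂(ν i)) * (∫ a, χ a ∂(ν j)) * ∏ l ∈ (univ.erase i).erase j, ∫ a, k l a ∂(ν l) := by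
  have hj : j ∈ univ.erase i := mem_erase.2 ⟨hij.symm, mem_univ j⟩
  simp_rw [mul_mul_prod_erase_erase hij]
  rw [integral_mul_prod_erase_pi (μ := ν) i ψ (Function.update k j χ),
    ← mul_prod_erase (univ.erase i) _ hj, Function.update_self, mul_assoc]
  congr 2
  exact prod_congr rfl fun l hl => by rw [Function.update_of_ne (ne_of_mem_erase hl)]

/-- `K(x)·gᵢ(xᵢ)gⱼ(xⱼ)` is `Measure.pi`-integrable for every pair of blocks
(`k_l, k_l g_l² ∈ L¹`, `k_l ≥ 0`). [folklore] -/
theorem integrable_piKernel_mul_mul {k g : (l : ι) → X l → ℝ} (hk0 : ∀ l a, 0 ≤ k l a)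
    (hki : ∀ l, Integrable (k l) (ν l)) (hgm : ∀ l, Measurable (g l))
    (hkg2 : ∀ l, Integrable (fun a => k l a * g l a ^ 2) (ν l)) (i j : ι) :
    Integrable (fun x : (l : ι) → X l => (∏ l, k l (x l)) * (g i (x i) * g j (x j)))
      (Measure.pi ν) := by
  -- dominated by `K (gᵢ² + gⱼ²)/2`, each `K g_l²` being a product of one-coordinate integrands
  have hsq : ∀ l₀ : ι, Integrable (fun x : (l : ι) → X l => (∏ l, k l (x l)) * g l₀ (x l₀) ^ 2)
      (Measure.pi ν) := by
    intro l₀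
    have h := integrable_mul_prod_erase_pi (μ := ν) l₀ (φ := k) (hkg2 l₀) hki
    refine h.congr (Eventually.of_forall fun x => ?_)
    simp only
    rw [piKernel_mul_sq_eq]
  have hKm : AEStronglyMeasurable (fun x : (l : ι) → X l => ∏ l, k l (x l)) (Measure.pi ν) :=
    (Integrable.fintype_prod_dep (f := k) hki).1
  refine ((hsq i).add (hsq j)).mono'
    (hKm.mul ((((hgm i).comp (measurable_pi_apply i)).mul
      ((hgm j).comp (measurable_pi_apply j))).aestronglyMeasurable)) (Eventually.of_forall fun x => ?_)
  have hK0 : 0 ≤ ∏ l, k l (x l) := prod_nonneg fun l _ => hk0 _ _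
  show ‖(∏ l, k l (x l)) * (g i (x i) * g j (x j))‖
    ≤ (∏ l, k l (x l)) * g i (x i) ^ 2 + (∏ l, k l (x l)) * g j (x j) ^ 2
  rw [Real.norm_eq_abs, abs_mul, abs_of_nonneg hK0, ← mul_add]
  refine mul_le_mul_of_nonneg_left ?_ hK0
  rw [abs_mul]
  nlinarith [sq_nonneg (|g i (x i)| - |g j (x j)|), sq_abs (g i (x i)), sq_abs (g j (x j)),
    abs_nonneg (g i (x i)), abs_nonneg (g j (x j))]

/-- `K(x)·(Σᵢ gᵢ(xᵢ))²` is `Measure.pi`-integrable. [folklore] -/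
theorem integrable_piKernel_mul_sum_sq {k g : (l : ι) → X l → ℝ} (hk0 : ∀ l a, 0 ≤ k l a)
    (hki : ∀ l, Integrable (k l) (ν l)) (hgm : ∀ l, Measurable (g l))
    (hkg2 : ∀ l, Integrable (fun a => k l a * g l a ^ 2) (ν l)) :
    Integrable (fun x : (l : ι) → X l => (∏ l, k l (x l)) * (∑ i, g i (x i)) ^ 2)
      (Measure.pi ν) := by
  have e : (fun x : (l : ι) → X l => (∏ l, k l (x l)) * (∑ i, g i (x i)) ^ 2)
      = fun x => ∑ i, ∑ j, (∏ l, k l (x l)) * (g i (x i) * g j (x j)) := by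
    funext x
    rw [sq, sum_mul_sum, mul_sum]
    exact sum_congr rfl fun i _ => mul_sum _ _ _
  rw [e]
  exact integrable_finsetSum _ fun i _ => integrable_finsetSum _ fun j _ =>
    integrable_piKernel_mul_mul hk0 hki hgm hkg2 i j

/-- `K(x)·Σᵢ gᵢ(xᵢ)` is `Measure.pi`-integrable. [folklore] -/
theorem integrable_piKernel_mul_sum {k g : (l : ι) → X l → ℝ} (hki : ∀ l, Integrable (k l) (ν l))
    (hkg : ∀ l, Integrable (fun a => k l a * g l a) (ν l)) :
    Integrable (fun x : (l : ι) → X l => (∏ l, k l (x l)) * ∑ i, g i (x i)) (Measure.pi ν) := by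
  have e : (fun x : (l : ι) → X l => (∏ l, k l (x l)) * ∑ i, g i (x i))
      = fun x => ∑ i, (∏ l, k l (x l)) * g i (x i) := by
    funext x; rw [mul_sum]
  rw [e]
  refine integrable_finsetSum _ fun i _ => ?_
  have h := integrable_mul_prod_erase_pi (μ := ν) i (φ := k) (hkg i) hki
  refine h.congr (Eventually.of_forall fun x => ?_)
  simp only
  rw [piKernel_mul_eq]

/-- **THE CENTRED SECOND MOMENT OF A SUM OF INDEPENDENT BLOCK TERMS.**  Under the product kernel
`K(x) = ∏ᵢ kᵢ(xᵢ)` (`kᵢ ≥ 0`), for block functions `gᵢ` with `kᵢ gᵢ² ∈ L¹` and `∫ kᵢ gᵢ dνᵢ = 0`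
for every block: `∫ K(x)·(Σᵢ gᵢ(xᵢ))² d(⊗ν) = Σᵢ (∫ kᵢ gᵢ² dνᵢ)·∏_{l ≠ i} ∫ k_l dν_l` — the
diagonal; every off-diagonal term contains a factor `∫ kᵢ gᵢ = 0`. [ours] -/
theorem integral_piKernel_mul_sq_sum {k g : (l : ι) → X l → ℝ} (hk0 : ∀ l a, 0 ≤ k l a)
    (hki : ∀ l, Integrable (k l) (ν l)) (hgm : ∀ l, Measurable (g l))
    (hkg2 : ∀ l, Integrable (fun a => k l a * g l a ^ 2) (ν l))
    (hkg0 : ∀ l, ∫ a, k l a * g l a ∂(ν l) = 0) :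
    ∫ x, (∏ l, k l (x l)) * (∑ i, g i (x i)) ^ 2 ∂(Measure.pi ν)
      = ∑ i, (∫ a, k i a * g i a ^ 2 ∂(ν i)) * ∏ l ∈ univ.erase i, ∫ a, k l a ∂(ν l) := by
  have e : ∀ x : (l : ι) → X l, (∏ l, k l (x l)) * (∑ i, g i (x i)) ^ 2
      = ∑ i, ∑ j, (∏ l, k l (x l)) * (g i (x i) * g j (x j)) := by
    intro x
    rw [sq, sum_mul_sum, mul_sum]
    exact sum_congr rfl fun i _ => mul_sum _ _ _
  simp_rw [e]
  rw [integral_finsetSum _ fun i _ => integrable_finsetSum _ fun j _ =>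
    integrable_piKernel_mul_mul hk0 hki hgm hkg2 i j]
  have hswap : ∀ i : ι, ∫ x, ∑ j, (∏ l, k l (x l)) * (g i (x i) * g j (x j)) ∂(Measure.pi ν)
      = ∑ j, ∫ x, (∏ l, k l (x l)) * (g i (x i) * g j (x j)) ∂(Measure.pi ν) :=
    fun i => integral_finsetSum _ fun j _ => integrable_piKernel_mul_mul hk0 hki hgm hkg2 i j
  rw [sum_congr rfl fun i _ => hswap i]
  have hdiag : ∀ i : ι, ∫ x, (∏ l, k l (x l)) * (g i (x i) * g i (x i)) ∂(Measure.pi ν)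
      = (∫ a, k i a * g i a ^ 2 ∂(ν i)) * ∏ l ∈ univ.erase i, ∫ a, k l a ∂(ν l) := by
    intro i
    have e1 : ∀ x : (l : ι) → X l, (∏ l, k l (x l)) * (g i (x i) * g i (x i))
        = (k i (x i) * g i (x i) ^ 2) * ∏ l ∈ univ.erase i, k l (x l) := by
      intro x; rw [← sq, piKernel_mul_sq_eq]
    simp_rw [e1]
    exact integral_mul_prod_erase_pi (μ := ν) i (fun a => k i a * g i a ^ 2) k
  have hoff : ∀ i j : ι, i ≠ j →
      ∫ x, (∏ l, k l (x l)) * (g i (x i) * g j (x j)) ∂(Measure.pi ν) = 0 := by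
    intro i j hij
    simp_rw [piKernel_mul_mul_eq k g hij]
    rw [integral_mul_mul_prod_erase_erase_pi (ν := ν) hij (fun a => k i a * g i a)
      (fun a => k j a * g j a) k, hkg0 i, zero_mul, zero_mul]
  refine sum_congr rfl fun i _ => ?_
  rw [← add_sum_erase univ _ (mem_univ i), hdiag i, sum_eq_zero fun j hj =>
    hoff i j (ne_of_mem_erase hj).symm, add_zero]

/-- **Identical blocks**: with one block space, kernel `k` and function `g` (`∫ k g = 0`),
`∫ K(x)·(Σᵢ g(xᵢ))² d(⊗ν) = m·(∫ k g² dν)·(∫ k dν)^{m−1}`, `m = card ι` (for `m = 0` both sides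
vanish; `m − 1` is natural subtraction). [ours] -/
theorem integral_piKernel_mul_sq_sum_const {Y : Type*} [MeasurableSpace Y] {μ : Measure Y}
    [SigmaFinite μ] {k g : Y → ℝ} (hk0 : ∀ a, 0 ≤ k a) (hki : Integrable k μ) (hgm : Measurable g)
    (hkg2 : Integrable (fun a => k a * g a ^ 2) μ) (hkg0 : ∫ a, k a * g a ∂μ = 0) :
    ∫ x, (∏ l, k (x l)) * (∑ i, g (x i)) ^ 2 ∂(Measure.pi fun _ : ι => μ)
      = Fintype.card ι * (∫ a, k a * g a ^ 2 ∂μ) * (∫ a, k a ∂μ) ^ (Fintype.card ι - 1) := by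
  rw [integral_piKernel_mul_sq_sum (X := fun _ : ι => Y) (ν := fun _ : ι => μ) (k := fun _ => k)
    (g := fun _ => g) (fun _ => hk0) (fun _ => hki) (fun _ => hgm) (fun _ => hkg2) fun _ => hkg0]
  simp only [prod_const, card_erase_of_mem (mem_univ _), card_univ, sum_const, nsmul_eq_mul]
  ring

end Engine

/-! ## §3 Pointwise bookkeeping for product densities -/

section Pointwise

variable {ι : Type*} [Fintype ι] {X : ι → Type*}

/-- `√(P(x)Q(x)) = ∏ᵢ √(pᵢ(xᵢ)qᵢ(xᵢ))` for nonnegative block densities. [folklore] -/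
theorem sqrt_piDensity_mul {p q : (l : ι) → X l → ℝ} (hp0 : ∀ l a, 0 ≤ p l a)
    (hq0 : ∀ l a, 0 ≤ q l a) (x : (l : ι) → X l) :
    Real.sqrt ((∏ i, p i (x i)) * ∏ i, q i (x i)) = ∏ i, Real.sqrt (p i (x i) * q i (x i)) := by
  rw [← prod_mul_distrib, Real.sqrt_prod _ fun i _ => mul_nonneg (hp0 _ _) (hq0 _ _)]

/-- On the support of the block kernel the log weight of the product is the sum of the block log
weights: if `∏ᵢ √(pᵢ(xᵢ)qᵢ(xᵢ)) ≠ 0` then `log(P(x)/Q(x)) = Σᵢ log(pᵢ(xᵢ)/qᵢ(xᵢ))`. [folklore] -/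
theorem log_piDensity_div (p q : (l : ι) → X l → ℝ) (x : (l : ι) → X l)
    (hx : ∏ i, Real.sqrt (p i (x i) * q i (x i)) ≠ 0) :
    Real.log ((∏ i, p i (x i)) / ∏ i, q i (x i)) = ∑ i, Real.log (p i (x i) / q i (x i)) := by
  have hne : ∀ i ∈ univ, Real.sqrt (p i (x i) * q i (x i)) ≠ 0 := prod_ne_zero_iff.1 hx
  have hpq : ∀ i, p i (x i) ≠ 0 ∧ q i (x i) ≠ 0 := by
    intro i
    have h := hne i (mem_univ i)
    have hpos : 0 < p i (x i) * q i (x i) := by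
      by_contra hle
      exact h (Real.sqrt_eq_zero'.2 (not_lt.1 hle))
    exact mul_ne_zero_iff.1 hpos.ne'
  rw [Real.log_div (prod_ne_zero_iff.2 fun i _ => (hpq i).1)
      (prod_ne_zero_iff.2 fun i _ => (hpq i).2),
    Real.log_prod (fun i _ => (hpq i).1), Real.log_prod (fun i _ => (hpq i).2), ← sum_sub_distrib]
  exact sum_congr rfl fun i _ => (Real.log_div (hpq i).1 (hpq i).2).symm

/-- **The pair kernel sees only the gap of the centred sums.**  For block densities, any
centring constants `cᵢ, dᵢ` and all `x, x′`:
`K(x)K(x′)·|log(P(x)/Q(x)) − log(P(x′)/Q(x′))| = K(x)K(x′)·|G(x) − G(x′)|` with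
`K(x) = ∏√(pᵢqᵢ)(xᵢ)` and `G(x) = Σᵢ ((log(pᵢ(xᵢ)/qᵢ(xᵢ)) − cᵢ) − dᵢ)`. [ours] -/
theorem piKernel_mul_abs_log_sub (p q : (l : ι) → X l → ℝ) (c d : ι → ℝ) (x x' : (l : ι) → X l) :
    (∏ i, Real.sqrt (p i (x i) * q i (x i))) * (∏ i, Real.sqrt (p i (x' i) * q i (x' i)))
        * |Real.log ((∏ i, p i (x i)) / ∏ i, q i (x i))
            - Real.log ((∏ i, p i (x' i)) / ∏ i, q i (x' i))|
      = (∏ i, Real.sqrt (p i (x i) * q i (x i))) * (∏ i, Real.sqrt (p i (x' i) * q i (x' i)))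
        * |(∑ i, ((Real.log (p i (x i) / q i (x i)) - c i) - d i))
            - ∑ i, ((Real.log (p i (x' i) / q i (x' i)) - c i) - d i)| := by
  by_cases hx : ∏ i, Real.sqrt (p i (x i) * q i (x i)) = 0
  · rw [hx, zero_mul, zero_mul, zero_mul]
  by_cases hx' : ∏ i, Real.sqrt (p i (x' i) * q i (x' i)) = 0
  · rw [hx', mul_zero, zero_mul, zero_mul]
  rw [log_piDensity_div p q x hx, log_piDensity_div p q x' hx']
  congr 2
  simp only [sum_sub_distrib]
  ring

end Pointwise

end Summit.Ventures.LatticeQCDFlow.Theory2
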